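import Summits.QuantumFields.BalabanUV.Beta.D1BFx.KCombineCovColourTorus

/-!
# `BalabanUV.Beta.D1BFx.KCombineCovStripped` — road «BF-x» for binder row D1, slot (K), (K) CLOSURE PLAN (R1-L) §2 (A1): **«K-COV-C» PART 3 — THE
# `ℤ⁴` IDENTITY OF THE COVARIANT ORGANISATION FROM PARITY-TYPED PER-TORUS LETTERS.**  `KCombineCovTowers.hessKer_transfer_road_cov_towers` (p255423)
# displays ONE per-torus hypothesis `hId` (the identity in array currency, `∀ k`); `KCombineCov` §3′ — which was to produce it — is honest-symmetric and
# NOT instantiable at the literal's colourless jets (F-leaf03-g11-1 = F-g6-1 for the (R1-L) twin).  THIS MODULE produces the `ℤ⁴` identity from the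
# STRIPPED per-torus dictionary step (PART 2 `identity_array_currency_cov_What0_stripped`) fed, on every torus, by: the literal's PARITY-TYPED jets
# (`kₛ`, `kₜ` antisymmetric, `kₛₜ` symmetric; constraint jets `q•`), their ONE-SIDED WARD-L letters against THE CONVENTION's gauge jets
# (`Wₛ = Ê_b N̂`, `Wₛₜ = [b=b′]Ê_b N̂`, `b = (σ0, μ)`, `b′ = (σz, ν)`), the kinematic letters, and the (A2-M∕N) DICTIONARY letters in F-g6-1's placement —
# M-side `kkt kₛ qₛ = (arr 𝒱M μ 0)ˆˢ`, `kkt kₜ qₜ = (arr 𝒱M ν z)ˆˢ`, `kkt kₛₜ qₛₜ · D = (arr 𝒲M μ 0 ν z)ˆˢ` (`ˆˢ = blocksHat ∘ sortK`), N-side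
# `tj₂ (kₛ + B̃ₛ) qₛ = (arr 𝒱N μ 0)ˆˢ`, …, `kkt (kₛₜ + B̃ₛₜ) qₛₜ = (arr 𝒲N μ 0 ν z)ˆˢ` with TB4-W's TWISTED weight jets `B̃• = tgram•(Tjet• N̂ e₁, Ajet• N̂)` —
# and NOTHING ELSE: the co-frame data, the N-LEG letter, the five determinants, the parity types of the inverse jets, both tower slots and all four
# `ℤ⁴` limits are tree theorems BY NAME (`KCombineCovLegs`, `KCombineCovCombLeg`, `KGramCovJets`, `CombFPWordArrays`, `KCombineCovTowers`, PART 2, TB5-2a∕2b);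
# the mixed pair word needs `|z|₁ + 3 ≤ (m+1)·p k`, which holds EVENTUALLY along `p k → ∞` (`KCombineCov.hessKer_transfer_road_cov_limits`).

HONEST FRAMING (cell contract, verbatim): «discharging `BetaPertH` makes Bałaban's UV stability UNCONDITIONAL — a real constructive-QFT
result; it is NOT the continuum limit and NOT the Clay problem.»  HONEST DEPENDENCY (verbatim): «continuum YM on T⁴ ⇐ BetaPertH ∧ nine
spine estimates (0/9 proved); BetaPertH ⇐ (D1) ∧ (D4) ∧ CAP+tail; G-an2-4 gates asym, D1 and NE2/3/4.»  THIS MODULE DISCHARGES NOTHING of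
D1 ∕ BetaPertH: [folklore] one `Filter.Eventually` bookkeeping lemma and a composition BY NAME.  No `def`, no `def … : Prop`, nothing cited, 0 sorry.
STILL DISPLAYED (what slot (K)'s identity side owes after this file): WARD-L for the typed literal (Q1 — the one-sided letters `a•` are HYPOTHESES),
the kinematic letters `b•`, and the (A2-M∕N) dictionary `hJM•`∕`hJN•` (which periodised tables of the literal ARE `kₛ`, `qₛ`, … — an2's Q2); `Spr (Ga (m+1) a)`
(printed [B5, Prop. 1.2] by name elsewhere), `r ∈ box 4 (m+1)`, the M∕N families' BiLoc letters.  NOT summit progress; NOT BetaPertH, NOT continuum, NOT Clay.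

ABSOLUTE RULE (cell, verbatim): «No internally-minted statement may enter as a cited fact. Every hypothesis is either kernel-proved in this
package or a verbatim quotation of a PUBLISHED theorem with page reference. The manuscript(s) under audit are NOT citable for their own
disputed steps — they are the thing under adjudication; programme-internal (2001/route/tribunal) claims are never citable.»

CONTENT (all [folklore]): §1 `eventually_l1_add_three_le` (`|0−z|₁ + 3 ≤ (m+1)·p k` eventually); §2 **`hessKer_transfer_road_cov_stripped`**:
`hessKer G_M 𝒱M 𝒲M μ ν z + hessKer (Cgh (m+1) a) Lgh Lgh₂ μ ν z = hessKer (NlegRoad m a) 𝒱N 𝒲N μ ν z + 2·hessKer idK1 nFcol nFcolMix μ ν z`,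
`G_M = coDressKBmAt (toSite r) (m+1) (KInvStep (m+1) 0)`.
Unit `b2b-balaban-beta-d1-formalise-leaf-03` (gen 11); road owner `b2b-balaban-beta-d1-p2`.
-/

noncomputable section

namespace Summit.QuantumFields.BalabanUV.Beta.D1BFx.KCombineCovStripped

open Matrix Filter Topology
open scoped BigOperators
open Literature.MathematicalPhysics.QuantumFieldTheory.Balaban1983to89
open Literature.MathematicalPhysics.QuantumFieldTheory.Balaban1983to89.Beta
open Literature.MathematicalPhysics.QuantumFieldTheory.Balaban1983to89.Beta.Composition (kkt)
open B12Sec2to5 (l1 l1_nonneg)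
open ExpKernelCalculus (MKer Decays BiLoc hessKer)
open AffineAveraging (box toSite unitVec)
open OneStepResolventKernel (Fib)
open OneStepKernelFamily (KInvStep)
open Summit.QuantumFields.BalabanUV.Beta.TameKernelCalculus (Spr)
open Summit.QuantumFields.BalabanUV.Beta.AxialDressingRooted (coDressKBmAt)
open Summit.QuantumFields.BalabanUV.Beta.D1BFx.FibredPeriodisation (periodiseF)
open Summit.QuantumFields.BalabanUV.Beta.D1BFx.SortedKernels (blocksHat)
open Summit.QuantumFields.BalabanUV.Beta.D1BFx.SortedPack (sortK)
open Summit.QuantumFields.BalabanUV.Beta.D1BFx.SortedEmbedding (e₁)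
open Summit.QuantumFields.BalabanUV.Beta.D1BFx.PeriodicArrays (arr toF)
open Summit.QuantumFields.BalabanUV.Beta.D1BFx.MixedVarPackedHess (hessT)
open Summit.QuantumFields.BalabanUV.Beta.D1BFx.GramWeightJets (gram₀)
open Summit.QuantumFields.BalabanUV.Beta.D1BFx.GramWeightColourLift (tj₂ tgram₁ tgramMix)
open Summit.QuantumFields.BalabanUV.Beta.D1BFx.TorusCombKKT (I J CombRows tauT Khat Qhat)
open Summit.QuantumFields.BalabanUV.Beta.D1BFx.TorusGaugeBasis (What0)
open Summit.QuantumFields.BalabanUV.Beta.D1BFx.TorusGaugeBasisMatrix (Nhat)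
open Summit.QuantumFields.BalabanUV.Beta.D1BFx.TorusCoframeJets (Djet Tjet₀ Tjet₁ Tjet₁₁ Ajet₀ Ajet₁ Ajet₁₁)
open Summit.QuantumFields.BalabanUV.Beta.D1BFx.RWeightedLegPack (NlegRoad)
open Summit.QuantumFields.BalabanUV.Beta.D1BFx.GaugeJetLocal (idK1)
open Summit.QuantumFields.BalabanUV.Beta.D1BFx.KGhostLeg (Cgh)
open Summit.QuantumFields.BalabanUV.Beta.D1BFx.TorusGhostWordArrays (Lgh)
open Summit.QuantumFields.BalabanUV.Beta.D1BFx.TorusGhostPairStencils (Lgh₂)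
open Summit.QuantumFields.BalabanUV.Beta.D1BFx.CombFPWordArrays (nFcol hessT_combFP_What0_eq_arr)
open Summit.QuantumFields.BalabanUV.Beta.D1BFx.KLimitGluon (tendsto_hessT_NlegRoad)
open Summit.QuantumFields.BalabanUV.Beta.D1BFx.KCombineCov (hessKer_transfer_road_cov_limits)
open Summit.QuantumFields.BalabanUV.Beta.D1BFx.KCombineCovLegs (det_Tjet₀_mul_What0_ne_zero det_Ajet₀_Nhat_ne_zero det_gram₀_What0_road_ne_zero
  inv_kkt_gram₀_Tjet_Nhat_eq_blocksHat)
open Summit.QuantumFields.BalabanUV.Beta.D1BFx.KCombineCovTowers (combFPMix_eq_of_lt tendsto_gramCov_tower tendsto_combFP_tower)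
open Summit.QuantumFields.BalabanUV.Beta.D1BFx.KCombineCovColourTorus (identity_array_currency_cov_What0_stripped hessT_tgramCov_What0_eq_arr
  transpose_Ajet₀ transpose_Ajet₁ transpose_Ajet₁₁)

/-! ## §1 The pair-word side condition holds eventually along the road's tori -/

section Eventually

variable (m : ℕ)

/-- [folklore] Along `p k → ∞`, eventually `|0 − z|₁ + 3 ≤ (m+1)·p k`. -/
theorem eventually_l1_add_three_le (z : Fin 4 → ℤ) {p : ℕ → ℕ} (hp : Tendsto p atTop atTop) :
    ∀ᶠ k in atTop, l1 (0 - z) + 3 ≤ (((m + 1) * p k : ℕ) : ℝ) := by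
  obtain ⟨N, hN⟩ := exists_nat_ge (l1 (0 - z) + 3)
  filter_upwards [hp.eventually_ge_atTop N] with k hk
  have h1 : (N : ℝ) ≤ (p k : ℝ) := by exact_mod_cast hk
  have h2 : (p k : ℝ) ≤ (((m + 1) * p k : ℕ) : ℝ) := by exact_mod_cast Nat.le_mul_of_pos_left (p k) (Nat.succ_pos m)
  linarith

end Eventually

/-! ## §2 The `ℤ⁴` identity from parity-typed per-torus letters -/

section Combine

variable (m : ℕ) {a : ℝ} {r : Fin 4 → ℕ}

/-- [folklore] **«K-COV-C» PART 3 — THE `ℤ⁴` IDENTITY OF THE (R1-L) ORGANISATION FROM PARITY-TYPED PER-TORUS LETTERS.**  For `0 < a`, `Spr (Ga (m+1) a)`,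
`r ∈ box 4 (m+1)`, bilocalised M∕N table families `𝒱M 𝒲M 𝒱N 𝒲N`, coarse periods `p k → ∞`, and ON EVERY TORUS `p k`: co-frame data `T• k`, `A• k` PINNED to
TB4-W's jets at `N̂` (letters `hT•`, `hA•`), gauge jets `W• k` PINNED to THE CONVENTION at `b = (σ0, μ)`, `b′ = (σz, ν)` (letters `hW•`), the literal's
PARITY-TYPED form jets `kₛ k`, `kₜ k` (antisymmetric), `kₛₜ k` (symmetric) and constraint jets `q• k` with their ONE-SIDED WARD-L letters `a•` and kinematic
letters `b•`, and the (A2-M∕N) DICTIONARY letters `hJM•` (F-g6-1 placement: plain `kkt` first-order tables, `kkt kₛₜ qₛₜ · D` second-order) ∕ `hJN•`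
(signed `tj₂` first N-jets with the TWISTED weight jets `tgram•(T• k, A• k)`):
`hessKer G_M 𝒱M 𝒲M μ ν z + hessKer (Cgh (m+1) a) Lgh Lgh₂ μ ν z = hessKer (NlegRoad m a) 𝒱N 𝒲N μ ν z + 2·hessKer idK1 nFcol nFcolMix μ ν z`. -/
theorem hessKer_transfer_road_cov_stripped (ha : 0 < a) (hGa : Spr (GluonLeg.Ga (m + 1) a)) (hr : r ∈ box (3 + 1) (m + 1))
    (𝒱M : Fin 4 → (Fin 4 → ℤ) → MKer 4 (Fib 3)) (𝒲M : Fin 4 → (Fin 4 → ℤ) → Fin 4 → (Fin 4 → ℤ) → MKer 4 (Fib 3))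
    (𝒱N : Fin 4 → (Fin 4 → ℤ) → MKer 4 (Fib 3)) (𝒲N : Fin 4 → (Fin 4 → ℤ) → Fin 4 → (Fin 4 → ℤ) → MKer 4 (Fib 3))
    (μ ν : Fin 4) (z : Fin 4 → ℤ)
    {PM PM' QM QM' PN PN' QN QN' : Fin 4 → ℤ} {CvM CvM' CM δM CvN CvN' CN δN : ℝ}
    (hVM : BiLoc (𝒱M μ 0) PM PM' CvM δM) (hVM' : BiLoc (𝒱M ν z) QM' QM CvM' δM) (hWM : BiLoc (𝒲M μ 0 ν z) PM QM CM δM) (hδM : 0 < δM)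
    (hVN : BiLoc (𝒱N μ 0) PN PN' CvN δN) (hVN' : BiLoc (𝒱N ν z) QN' QN CvN' δN) (hWN : BiLoc (𝒲N μ 0 ν z) PN QN CN δN) (hδN : 0 < δN)
    {p : ℕ → ℕ} [∀ k, NeZero (p k)] (hp : Tendsto p atTop atTop)
    -- co-frame data pinned to TB4-W's jets
    (T₀ Tₛ Tₜ Tₛₜ : ∀ k, Matrix (CombRows (toSite r) (m + 1) (p k)) (I 3 (m + 1) (p k)) ℝ)
    (A₀ Aₛ Aₜ Aₛₜ : ∀ k, Matrix (CombRows (toSite r) (m + 1) (p k)) (CombRows (toSite r) (m + 1) (p k)) ℝ)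
    (hT₀ : ∀ k, T₀ k = Tjet₀ ((m + 1) * p k) (Nhat r (m + 1) (p k)) (e₁ (m + 1) (p k)))
    (hTₛ : ∀ k, Tₛ k = Tjet₁ ((m + 1) * p k) (siteOf 4 ((m + 1) * p k) 0, μ) (Nhat r (m + 1) (p k)) (e₁ (m + 1) (p k)))
    (hTₜ : ∀ k, Tₜ k = Tjet₁ ((m + 1) * p k) (siteOf 4 ((m + 1) * p k) z, ν) (Nhat r (m + 1) (p k)) (e₁ (m + 1) (p k)))
    (hTₛₜ : ∀ k, Tₛₜ k = Tjet₁₁ ((m + 1) * p k) (siteOf 4 ((m + 1) * p k) 0, μ) (siteOf 4 ((m + 1) * p k) z, ν)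
      (Nhat r (m + 1) (p k)) (e₁ (m + 1) (p k)))
    (hA₀ : ∀ k, A₀ k = Ajet₀ ((m + 1) * p k) (Nhat r (m + 1) (p k)))
    (hAₛ : ∀ k, Aₛ k = Ajet₁ ((m + 1) * p k) (siteOf 4 ((m + 1) * p k) 0, μ) (Nhat r (m + 1) (p k)))
    (hAₜ : ∀ k, Aₜ k = Ajet₁ ((m + 1) * p k) (siteOf 4 ((m + 1) * p k) z, ν) (Nhat r (m + 1) (p k)))
    (hAₛₜ : ∀ k, Aₛₜ k = Ajet₁₁ ((m + 1) * p k) (siteOf 4 ((m + 1) * p k) 0, μ) (siteOf 4 ((m + 1) * p k) z, ν) (Nhat r (m + 1) (p k)))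
    -- gauge jets pinned to THE CONVENTION
    (Wₛ Wₜ Wₛₜ : ∀ k, Matrix (I 3 (m + 1) (p k)) (CombRows (toSite r) (m + 1) (p k)) ℝ)
    (hWₛ : ∀ k, Wₛ k = (Djet ((m + 1) * p k) (siteOf 4 ((m + 1) * p k) 0, μ)).submatrix (e₁ (m + 1) (p k)) id * Nhat r (m + 1) (p k))
    (hWₜ : ∀ k, Wₜ k = (Djet ((m + 1) * p k) (siteOf 4 ((m + 1) * p k) z, ν)).submatrix (e₁ (m + 1) (p k)) id * Nhat r (m + 1) (p k))
    (hWₛₜ : ∀ k, Wₛₜ k = if (siteOf 4 ((m + 1) * p k) 0, μ) = (siteOf 4 ((m + 1) * p k) z, ν)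
      then (Djet ((m + 1) * p k) (siteOf 4 ((m + 1) * p k) 0, μ)).submatrix (e₁ (m + 1) (p k)) id * Nhat r (m + 1) (p k) else 0)
    -- the literal's parity-typed jets, WARD-L one-sided letters, kinematic letters
    (kₛ kₜ kₛₜ : ∀ k, Matrix (I 3 (m + 1) (p k)) (I 3 (m + 1) (p k)) ℝ) (qₛ qₜ qₛₜ : ∀ k, Matrix (J 3 (p k)) (I 3 (m + 1) (p k)) ℝ)
    (hkₛ : ∀ k, (kₛ k)ᵀ = -kₛ k) (hkₜ : ∀ k, (kₜ k)ᵀ = -kₜ k) (hkₛₜ : ∀ k, (kₛₜ k)ᵀ = kₛₜ k)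
    (aₛ : ∀ k, kₛ k * What0 r (m + 1) (p k) + Khat (d := 3) (m + 1) (p k) * Wₛ k = 0)
    (aₜ : ∀ k, kₜ k * What0 r (m + 1) (p k) + Khat (d := 3) (m + 1) (p k) * Wₜ k = 0)
    (aₛₜ : ∀ k, kₛₜ k * What0 r (m + 1) (p k) + kₛ k * Wₜ k + kₜ k * Wₛ k + Khat (d := 3) (m + 1) (p k) * Wₛₜ k = 0)
    (bₛ : ∀ k, qₛ k * What0 r (m + 1) (p k) + Qhat (d := 3) (m + 1) (p k) * Wₛ k = 0)
    (bₜ : ∀ k, qₜ k * What0 r (m + 1) (p k) + Qhat (d := 3) (m + 1) (p k) * Wₜ k = 0)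
    (bₛₜ : ∀ k, qₛₜ k * What0 r (m + 1) (p k) + qₛ k * Wₜ k + qₜ k * Wₛ k + Qhat (d := 3) (m + 1) (p k) * Wₛₜ k = 0)
    -- the (A2-M∕N) dictionary
    (hJM : ∀ k, kkt (kₛ k) (qₛ k) = blocksHat (p k) (sortK (m + 1) (arr ((m + 1) * p k) (𝒱M μ 0))))
    (hJM' : ∀ k, kkt (kₜ k) (qₜ k) = blocksHat (p k) (sortK (m + 1) (arr ((m + 1) * p k) (𝒱M ν z))))
    (hJM'' : ∀ k, kkt (kₛₜ k) (qₛₜ k) * Matrix.fromBlocks (1 : Matrix (I 3 (m + 1) (p k)) (I 3 (m + 1) (p k)) ℝ) 0 0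
        (-1 : Matrix (J 3 (p k)) (J 3 (p k)) ℝ) = blocksHat (p k) (sortK (m + 1) (arr ((m + 1) * p k) (𝒲M μ 0 ν z))))
    (hJN : ∀ k, tj₂ (kₛ k + tgram₁ (T₀ k) (Tₛ k) (A₀ k) (Aₛ k)) (qₛ k) = blocksHat (p k) (sortK (m + 1) (arr ((m + 1) * p k) (𝒱N μ 0))))
    (hJN' : ∀ k, tj₂ (kₜ k + tgram₁ (T₀ k) (Tₜ k) (A₀ k) (Aₜ k)) (qₜ k) = blocksHat (p k) (sortK (m + 1) (arr ((m + 1) * p k) (𝒱N ν z))))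
    (hJN'' : ∀ k, kkt (kₛₜ k + tgramMix (T₀ k) (Tₛ k) (Tₜ k) (Tₛₜ k) (A₀ k) (Aₛ k) (Aₜ k) (Aₛₜ k)) (qₛₜ k)
        = blocksHat (p k) (sortK (m + 1) (arr ((m + 1) * p k) (𝒲N μ 0 ν z)))) :
    hessKer (coDressKBmAt (toSite r) (m + 1) (KInvStep (d := 3) (m + 1) 0)) 𝒱M 𝒲M μ ν z
        + hessKer (Cgh (m + 1) a) (fun κ v => Lgh κ v) (fun κ v l v' => Lgh₂ κ v l v') μ ν z
      = hessKer (NlegRoad m a) 𝒱N 𝒲N μ ν z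
        + 2 * hessKer idK1 (fun κ v => nFcol r (m + 1) κ v) (fun κ v l v' => if v = v' ∧ κ = l then nFcol r (m + 1) κ v else 0) μ ν z := by
  refine hessKer_transfer_road_cov_limits (d := 3) hr 𝒱M 𝒲M μ ν z hVM hVM' hWM hδM hp
    (tendsto_gramCov_tower m ha μ ν z hp) (tendsto_hessT_NlegRoad m hGa 𝒱N 𝒲N μ ν z hVN hVN' hWN hδN hp) (tendsto_combFP_tower m hr μ ν z hp) ?_
  filter_upwards [eventually_l1_add_three_le m z hp] with k hk
  have hlt : l1 (0 - z) < (((m + 1) * p k : ℕ) : ℝ) := by linarith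
  -- the TB4-W data letters on this torus, by name after un-pinning
  have hA₀s : (A₀ k)ᵀ = A₀ k := by rw [hA₀ k]; exact transpose_Ajet₀ _ _
  have hAₛa : (Aₛ k)ᵀ = -Aₛ k := by rw [hAₛ k]; exact transpose_Ajet₁ _ _ _
  have hAₜa : (Aₜ k)ᵀ = -Aₜ k := by rw [hAₜ k]; exact transpose_Ajet₁ _ _ _
  have hAₛₜs : (Aₛₜ k)ᵀ = Aₛₜ k := by rw [hAₛₜ k]; exact transpose_Ajet₁₁ _ _ _ _
  have hTW : (T₀ k * What0 r (m + 1) (p k)).det ≠ 0 := by rw [hT₀ k]; exact det_Tjet₀_mul_What0_ne_zero m (p k) ha hr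
  have hA : (A₀ k).det ≠ 0 := by rw [hA₀ k]; exact det_Ajet₀_Nhat_ne_zero m (p k) ha hr
  have hΦ : (gram₀ (What0 r (m + 1) (p k)) (Khat (d := 3) (m + 1) (p k) + gram₀ (T₀ k) (A₀ k))).det ≠ 0 := by
    rw [hT₀ k, hA₀ k]; exact det_gram₀_What0_road_ne_zero m (p k) ha hr
  have hLN : (kkt (Khat (d := 3) (m + 1) (p k) + gram₀ (T₀ k) (A₀ k)) (Qhat (d := 3) (m + 1) (p k)))⁻¹
      = blocksHat (p k) (sortK (m + 1) (NlegRoad m a)) := by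
    rw [hT₀ k, hA₀ k]; exact inv_kkt_gram₀_Tjet_Nhat_eq_blocksHat m (p k) ha hGa hr
  -- the two tower slots on this torus
  have hbΦ := hessT_tgramCov_What0_eq_arr m (p k) ha hr μ ν 0 z hk (kₛ k) (kₜ k) (kₛₜ k) (hWₛ k) (hWₜ k) (hWₛₜ k) (aₛ k) (aₜ k) (aₛₜ k)
    (B₀ := gram₀ (T₀ k) (A₀ k)) (Bₛ := tgram₁ (T₀ k) (Tₛ k) (A₀ k) (Aₛ k)) (Bₜ := tgram₁ (T₀ k) (Tₜ k) (A₀ k) (Aₜ k))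
    (Bₛₜ := tgramMix (T₀ k) (Tₛ k) (Tₜ k) (Tₛₜ k) (A₀ k) (Aₛ k) (Aₜ k) (Aₛₜ k))
    (by rw [hT₀ k, hA₀ k]) (by rw [hT₀ k, hTₛ k, hA₀ k, hAₛ k]) (by rw [hT₀ k, hTₜ k, hA₀ k, hAₜ k])
    (by rw [hT₀ k, hTₛ k, hTₜ k, hTₛₜ k, hA₀ k, hAₛ k, hAₜ k, hAₛₜ k])
  have heτ := hessT_combFP_What0_eq_arr (m := m) (p := p k) hr μ ν 0 z (hWₛ k) (hWₜ k) (hWₛₜ k)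
  rw [combFPMix_eq_of_lt m ((m + 1) * p k) μ ν 0 z hlt] at heτ
  exact identity_array_currency_cov_What0_stripped (d := 3) (p k) hr (kₛ k) (kₜ k) (kₛₜ k) (T₀ k) (Tₛ k) (Tₜ k) (Tₛₜ k)
    (A₀ k) (Aₛ k) (Aₜ k) (Aₛₜ k) (Wₛ k) (Wₜ k) (Wₛₜ k) (qₛ k) (qₜ k) (qₛₜ k) (hkₛ k) (hkₜ k) (hkₛₜ k) hA₀s hAₛa hAₜa hAₛₜs
    (aₛ k) (aₜ k) (aₛₜ k) (bₛ k) (bₜ k) (bₛₜ k) hTW hA hΦ _ _ _ _ _ _ _ _ (hJM k) (hJM' k) (hJM'' k) hLN (hJN k) (hJN' k) (hJN'' k) hbΦ heτ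

end Combine

end Summit.QuantumFields.BalabanUV.Beta.D1BFx.KCombineCovStripped

end
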